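import Summits.BirchSwinnertonDyer.BirchSwinnertonDyer.Theorems.PrintX11aMultThreeOrbitDefs
import Literature.NumberTheory.Automorphic.CongruenceSubgroupPropertySL2AwayHolds
import HarnessLib

/-!
# Route `PrintX11a`, crux U3 `UpperNonSurjThree` (item stmt-BirchSwinnertonDyer-20613), line finemu3 — μ-road stub
# `stub_muAnHardThree`: the ATKIN–LEHNER-EXTENDED ORBIT SETUP in `GL₂(ℤ[1/3])`, part 2/3 ((h3), (h3′), (V))

Cell `bsd-print-x11a`, width seat bsd-line-x11a-p2 g2 (`--supports stmt-BirchSwinnertonDyer-20613 --as helper`). BSD is not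
proved by any of this; nothing is asserted about any curve. Pure group theory; see part 1/3 (`…OrbitDefs`) for the framing.

THIS FILE (2/3), for a level `N = 3M` with `3 ∤ M` and `W = (3x, y; 3M, 3)`, `3x − My = 1`:
* COSET SPLITTING of `Γ₀(M)` modulo `Γ₀(3M)` (index `4 = |P¹(𝔽₃)|`): `γ ∈ Γ₀(3M)` or `γ = γ₁ ξ' Tʲ`
  (`exists_eq_mul_xi_mul_T`, `j = d c` using `c² ≡ 1 (3)`); `γ = γ₁ (1 0; Mk 1)` or `γ = γ₁ ξ'`
  (`exists_eq_mul_lower_or_xi`, `k = c d M`);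
* (h3) `D* = Γ*·B*` and (h3′) `D* = Γ*·P*` (`deltaGL_eq_gammaStar_mul_upperGL/lowerGL`): scale the determinant away by
  `diag(1, det)`, apply the TREE's `deltaEqGamma0MulUpper/Lower` at `(3, M)`, then the coset splitting with
  `mapGL ξ' = W · diag(3,1)⁻¹` — `W` supplies exactly the missing transitivity on the cusp classes `[1/M]` and `[1/3]`;
* (V) at `(3, M)` transported to `GL₂(ℤ[1/3])` (`mapGL_mem_closure_upper_lower`): Vaserstein's
  `G(A, MA) ≤ E(A, MA)` over `A = ℤ[1/3]` is the tree theorem `SL2Rel.Away.relG_le_relE_span_natCast`.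
References: [Vaserstein1972SL2] Theorem; [Manin1972] Prop. 1.4; [Knapp1993] Lemma 9.24.
-/

set_option linter.dupNamespace false
set_option autoImplicit false

namespace Summit.BirchSwinnertonDyer.BirchSwinnertonDyer.Theorems.MultThreeOrbit

open scoped MatrixGroups
open CongruenceSubgroup Matrix.SpecialLinearGroup
open Summit.BirchSwinnertonDyer.BirchSwinnertonDyer.Theorems.ConjSpanGenAllLevels
  Literature.NumberTheory.EllipticCurves.Rank1Residual

noncomputable section

/-! ### Coset splitting `Γ₀(M) = Γ₀(3M) ⊔ ⋃ⱼ Γ₀(3M)·ξ'·Tʲ` and the decompositions (h3), (h3') -/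

section Cosets

variable {N M : ℕ} {x y : ℤ} (hbez : 3 * x - M * y = 1) (hNM : N = 3 * M) (h3M : ¬ 3 ∣ M)
include hNM h3M

omit hNM h3M in
/-- `3 ∣ 1 − c²` for `3 ∤ c`. [folklore] -/
theorem three_dvd_one_sub_mul_self {c : ℤ} (hc : ¬ (3 : ℤ) ∣ c) : (3 : ℤ) ∣ 1 - c * c := by
  have key : ∀ z : ZMod 3, z ≠ 0 → 1 - z * z = 0 := by decide
  have hz : (c : ZMod 3) ≠ 0 := by
    rwa [Ne, ZMod.intCast_zmod_eq_zero_iff_dvd]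
  have := key _ hz
  have h : (((1 - c * c : ℤ)) : ZMod 3) = 0 := by push_cast; exact this
  exact (ZMod.intCast_zmod_eq_zero_iff_dvd _ 3).mp h

omit hNM h3M in
/-- Membership in `Γ₀(N)` from an integer divisibility. [folklore] -/
theorem mem_Gamma0_of_dvd {γ : SL(2, ℤ)} (h : (N : ℤ) ∣ γ 1 0) : γ ∈ Gamma0 N := by
  rw [Gamma0_mem]
  exact (ZMod.intCast_zmod_eq_zero_iff_dvd _ N).mpr h

omit hNM h3M in
/-- The integer divisibility from membership in `Γ₀(N)`. [folklore] -/
theorem dvd_of_mem_Gamma0 {γ : SL(2, ℤ)} (h : γ ∈ Gamma0 N) : (N : ℤ) ∣ γ 1 0 :=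
  (ZMod.intCast_zmod_eq_zero_iff_dvd _ N).mp (Gamma0_mem.mp h)

/-- `3M ∣ z` from `3 ∣ z` and `M ∣ z` (`3 ∤ M`). [folklore] -/
theorem dvd_N_of_dvd {z : ℤ} (h3 : (3 : ℤ) ∣ z) (hM : (M : ℤ) ∣ z) : (N : ℤ) ∣ z := by
  have hcop : IsCoprime (3 : ℤ) (M : ℤ) := by
    rw [Int.isCoprime_iff_gcd_eq_one]
    have : Nat.Coprime 3 M := (Nat.Prime.coprime_iff_not_dvd Nat.prime_three).mpr h3M
    simpa [Int.gcd] using this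
  rw [hNM]; push_cast
  exact hcop.mul_dvd h3 hM

/-- **Coset splitting, `∞`-form**: every `γ ∈ Γ₀(M)` is `γ₁` or `γ₁ · ξ' · Tʲ` with `γ₁ ∈ Γ₀(3M)`. [folklore] -/
theorem exists_eq_mul_xi_mul_T (γ : SL(2, ℤ)) (hγ : γ ∈ Gamma0 M) :
    γ ∈ Gamma0 N ∨ ∃ γ₁ ∈ Gamma0 N, ∃ j : ℤ, γ = γ₁ * xiSL hbez * ModularGroup.T ^ j := by
  by_cases h3c : (3 : ℤ) ∣ γ 1 0
  · exact Or.inl (mem_Gamma0_of_dvd (dvd_N_of_dvd hNM h3M h3c (dvd_of_mem_Gamma0 hγ)))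
  · right
    set c : ℤ := γ 1 0 with hc
    set d : ℤ := γ 1 1 with hd
    set j : ℤ := d * c with hj
    set γ₁ : SL(2, ℤ) := γ * (ModularGroup.T ^ j)⁻¹ * (xiSL hbez)⁻¹ with hγ₁
    refine ⟨γ₁, mem_Gamma0_of_dvd ?_, j, by rw [hγ₁]; group⟩
    have h10 : (γ₁ 1 0 : ℤ) = 3 * c - M * (d * (1 - c * c)) := by
      rw [hγ₁, Matrix.SpecialLinearGroup.coe_mul, Matrix.SpecialLinearGroup.coe_mul,
        Matrix.SpecialLinearGroup.coe_inv, Matrix.SpecialLinearGroup.coe_inv, ModularGroup.coe_T_zpow, xiSL]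
      simp [Matrix.mul_apply, Fin.sum_univ_two, Matrix.adjugate_fin_two, hj, hc, hd]
      ring
    rw [h10]
    refine dvd_N_of_dvd hNM h3M ?_ ?_
    · exact dvd_sub (dvd_mul_right 3 c) (dvd_mul_of_dvd_right
        (dvd_mul_of_dvd_right (three_dvd_one_sub_mul_self h3c) d) _)
    · exact dvd_sub (dvd_mul_of_dvd_right (dvd_of_mem_Gamma0 hγ) 3) (dvd_mul_right _ _)

/-- **Coset splitting, `0`-form**: every `γ ∈ Γ₀(M)` is `γ₁ · (1 0; Mk 1)` or `γ₁ · ξ'` with `γ₁ ∈ Γ₀(3M)`.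
[folklore] -/
theorem exists_eq_mul_lower_or_xi (γ : SL(2, ℤ)) (hγ : γ ∈ Gamma0 M) :
    (∃ γ₁ ∈ Gamma0 N, ∃ k : ℤ, γ = γ₁ * lowerUnip ((M : ℤ) * k)) ∨
      ∃ γ₁ ∈ Gamma0 N, γ = γ₁ * xiSL hbez := by
  set c : ℤ := γ 1 0 with hc
  set d : ℤ := γ 1 1 with hd
  by_cases h3d : (3 : ℤ) ∣ d
  · right
    set γ₁ : SL(2, ℤ) := γ * (xiSL hbez)⁻¹ with hγ₁
    refine ⟨γ₁, mem_Gamma0_of_dvd ?_, by rw [hγ₁]; group⟩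
    have h10 : (γ₁ 1 0 : ℤ) = 3 * c - M * d := by
      rw [hγ₁, Matrix.SpecialLinearGroup.coe_mul, Matrix.SpecialLinearGroup.coe_inv, xiSL]
      simp [Matrix.mul_apply, Fin.sum_univ_two, Matrix.adjugate_fin_two, hc, hd]
      ring
    rw [h10]
    refine dvd_N_of_dvd hNM h3M ?_ ?_
    · exact dvd_sub (dvd_mul_right 3 c) (dvd_mul_of_dvd_right h3d _)
    · exact dvd_sub (dvd_mul_of_dvd_right (dvd_of_mem_Gamma0 hγ) 3) (dvd_mul_right _ _)
  · left
    have hMd : ¬ (3 : ℤ) ∣ d * M := by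
      intro h
      rcases (Int.prime_three.dvd_or_dvd h) with h | h
      · exact h3d h
      · exact h3M (by exact_mod_cast h)
    set k : ℤ := c * (d * M) with hk
    set γ₁ : SL(2, ℤ) := γ * (lowerUnip ((M : ℤ) * k))⁻¹ with hγ₁
    refine ⟨γ₁, mem_Gamma0_of_dvd ?_, k, by rw [hγ₁]; group⟩
    have h10 : (γ₁ 1 0 : ℤ) = c * (1 - (d * M) * (d * M)) := by
      rw [hγ₁, Matrix.SpecialLinearGroup.coe_mul, Matrix.SpecialLinearGroup.coe_inv, lowerUnip]
      simp [Matrix.mul_apply, Fin.sum_univ_two, Matrix.adjugate_fin_two, hk, hc, hd]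
      ring
    rw [h10]
    refine dvd_N_of_dvd hNM h3M ?_ ?_
    · exact dvd_mul_of_dvd_right (three_dvd_one_sub_mul_self hMd) c
    · exact dvd_mul_of_dvd_left (dvd_of_mem_Gamma0 hγ) _

omit hNM h3M in
/-- `mapGL ξ' = W · diag(3,1)⁻¹`. [folklore] -/
theorem mapGL_xiSL_eq : (mapGL A (xiSL hbez) : G) = WA hbez * d31⁻¹ := by
  rw [WA, mul_inv_cancel_right]

omit hNM h3M in
/-- `mapGL Tʲ ∈ B*`. [folklore] -/
theorem mapGL_T_zpow_mem_upperGL (j : ℤ) : (mapGL A (ModularGroup.T ^ j) : G) ∈ upperGL := by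
  show ((mapGL A (ModularGroup.T ^ j) : G) : Matrix (Fin 2) (Fin 2) A) 1 0 = 0
  rw [coe_mapGL_int, ModularGroup.coe_T_zpow]
  simp

omit hNM h3M in
/-- `mapGL (1 0; Mk 1) ∈ P*_M`. [folklore] -/
theorem mapGL_lowerUnip_mem_lowerGL (k : ℤ) : (mapGL A (lowerUnip ((M : ℤ) * k)) : G) ∈ lowerGL M := by
  refine ⟨?_, (k : A), ?_⟩
  · show ((mapGL A (lowerUnip ((M : ℤ) * k)) : G) : Matrix (Fin 2) (Fin 2) A) 0 1 = 0
    rw [coe_mapGL_int, lowerUnip]; simp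
  · show ((mapGL A (lowerUnip ((M : ℤ) * k)) : G) : Matrix (Fin 2) (Fin 2) A) 1 0 = _
    rw [coe_mapGL_int, lowerUnip]; simp

omit hNM h3M in
/-- `toGL ∘ ι = mapGL`. [folklore] -/
theorem toGL_iota (γ : SL(2, ℤ)) : (toGL (iota 3 γ) : G) = mapGL A γ := by
  apply Matrix.GeneralLinearGroup.ext
  intro i j
  rw [Matrix.SpecialLinearGroup.coe_GL_coe_matrix, coe_mapGL_int]
  simp

/-- **(h3) `D* = Γ*·B*`.** [folklore] -/
theorem deltaGL_eq_gammaStar_mul_upperGL {g : G} (hg : g ∈ DeltaGL M) :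
    ∃ γs ∈ GammaStar N hbez, ∃ b ∈ upperGL, g = γs * b := by
  obtain ⟨t, ht⟩ := hg
  set u : Aˣ := Matrix.GeneralLinearGroup.det g with hu
  set g' : G := g * (diag2 1 u)⁻¹ with hg'
  have hdet' : Matrix.det (g' : Matrix (Fin 2) (Fin 2) A) = 1 := by
    rw [← Matrix.GeneralLinearGroup.val_det_apply, hg', map_mul, map_inv, det_diag2, one_mul, ← hu,
      mul_inv_cancel, Units.val_one]
  set g'' : SL(2, A) := ⟨(g' : Matrix (Fin 2) (Fin 2) A), hdet'⟩ with hg''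
  have hgg : (toGL g'' : G) = g' := Units.ext rfl
  have h10 : g'' 1 0 = (M : A) * t := by
    show (g' : Matrix (Fin 2) (Fin 2) A) 1 0 = _
    rw [hg', Matrix.GeneralLinearGroup.coe_mul, Matrix.mul_apply, Fin.sum_univ_two]
    have h1 : (((diag2 1 u)⁻¹ : G) : Matrix (Fin 2) (Fin 2) A) 0 0 = 1 := rfl
    have h2 : (((diag2 1 u)⁻¹ : G) : Matrix (Fin 2) (Fin 2) A) 1 0 = 0 := rfl
    rw [h1, h2, ht]; ring
  obtain ⟨γ, hγ, b, hb, hdec⟩ :=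
    deltaEqGamma0MulUpper (p := 3) (N := M) Nat.prime_three h3M g'' ⟨t, h10⟩
  have hg_eq : g = mapGL A γ * (toGL b * diag2 1 u) := by
    have : g = g' * diag2 1 u := by rw [hg', inv_mul_cancel_right]
    rw [this, ← hgg, hdec, map_mul, toGL_iota, mul_assoc]
  rcases exists_eq_mul_xi_mul_T hbez hNM h3M γ hγ with hγN | ⟨γ₁, hγ₁, j, hγeq⟩
  · exact ⟨mapGL A γ, mapGL_mem_GammaStar hbez ⟨γ, hγN⟩, toGL b * diag2 1 u,
      mul_mem (toGL_mem_upperGL hb) (diag2_mem_upperGL 1 u), hg_eq⟩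
  · refine ⟨mapGL A γ₁ * WA hbez, mul_mem (mapGL_mem_GammaStar hbez ⟨γ₁, hγ₁⟩) (WA_mem_GammaStar hbez),
      d31⁻¹ * mapGL A (ModularGroup.T ^ j) * (toGL b * diag2 1 u),
      mul_mem (mul_mem (inv_mem (diag2_mem_upperGL three 1)) (mapGL_T_zpow_mem_upperGL j))
        (mul_mem (toGL_mem_upperGL hb) (diag2_mem_upperGL 1 u)), ?_⟩
    rw [hg_eq, hγeq, map_mul, map_mul, mapGL_xiSL_eq]
    simp only [mul_assoc]

/-- **(h3') `D* = Γ*·P*`.** [folklore] -/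
theorem deltaGL_eq_gammaStar_mul_lowerGL {g : G} (hg : g ∈ DeltaGL M) :
    ∃ γs ∈ GammaStar N hbez, ∃ q ∈ lowerGL M, g = γs * q := by
  obtain ⟨t, ht⟩ := hg
  set u : Aˣ := Matrix.GeneralLinearGroup.det g with hu
  set g' : G := g * (diag2 1 u)⁻¹ with hg'
  have hdet' : Matrix.det (g' : Matrix (Fin 2) (Fin 2) A) = 1 := by
    rw [← Matrix.GeneralLinearGroup.val_det_apply, hg', map_mul, map_inv, det_diag2, one_mul, ← hu,
      mul_inv_cancel, Units.val_one]
  set g'' : SL(2, A) := ⟨(g' : Matrix (Fin 2) (Fin 2) A), hdet'⟩ with hg''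
  have hgg : (toGL g'' : G) = g' := Units.ext rfl
  have h10 : g'' 1 0 = (M : A) * t := by
    show (g' : Matrix (Fin 2) (Fin 2) A) 1 0 = _
    rw [hg', Matrix.GeneralLinearGroup.coe_mul, Matrix.mul_apply, Fin.sum_univ_two]
    have h1 : (((diag2 1 u)⁻¹ : G) : Matrix (Fin 2) (Fin 2) A) 0 0 = 1 := rfl
    have h2 : (((diag2 1 u)⁻¹ : G) : Matrix (Fin 2) (Fin 2) A) 1 0 = 0 := rfl
    rw [h1, h2, ht]; ring
  obtain ⟨γ, hγ, q, hq, hdec⟩ :=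
    deltaEqGamma0MulLower (p := 3) (N := M) Nat.prime_three h3M g'' ⟨t, h10⟩
  have hg_eq : g = mapGL A γ * (toGL q * diag2 1 u) := by
    have : g = g' * diag2 1 u := by rw [hg', inv_mul_cancel_right]
    rw [this, ← hgg, hdec, map_mul, toGL_iota, mul_assoc]
  rcases exists_eq_mul_lower_or_xi hbez hNM h3M γ hγ with ⟨γ₁, hγ₁, k, hγeq⟩ | ⟨γ₁, hγ₁, hγeq⟩
  · refine ⟨mapGL A γ₁, mapGL_mem_GammaStar hbez ⟨γ₁, hγ₁⟩,
      mapGL A (lowerUnip ((M : ℤ) * k)) * (toGL q * diag2 1 u),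
      mul_mem (mapGL_lowerUnip_mem_lowerGL k) (mul_mem (toGL_mem_lowerGL hq) (diag2_mem_lowerGL M 1 u)), ?_⟩
    rw [hg_eq, hγeq, map_mul]
    simp only [mul_assoc]
  · refine ⟨mapGL A γ₁ * WA hbez, mul_mem (mapGL_mem_GammaStar hbez ⟨γ₁, hγ₁⟩) (WA_mem_GammaStar hbez),
      d31⁻¹ * (toGL q * diag2 1 u),
      mul_mem (inv_mem (diag2_mem_lowerGL M three 1))
        (mul_mem (toGL_mem_lowerGL hq) (diag2_mem_lowerGL M 1 u)), ?_⟩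
    rw [hg_eq, hγeq, map_mul, mapGL_xiSL_eq]
    simp only [mul_assoc]

end Cosets

/-! ### (V) at `(3, M)`: `mapGL γ ∈ ⟨B* ∪ P*_M⟩` for `γ ∈ Γ_H(M)` (Vaserstein over `ℤ[1/3]`, a tree theorem) -/

section Vaserstein

variable {M : ℕ}

/-- **(V) transported to `GL₂(ℤ[1/3])`**: for `M ≥ 1` and `γ ∈ Γ₀(M)` with `d ≡ ±3ᵏ (mod M)`,
`mapGL γ ∈ ⟨B* ∪ P*_M⟩` — Vaserstein's `G(A, MA) ≤ E(A, MA)` over `A = ℤ[1/3]` (tree theorem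
`SL2Rel.Away.relG_le_relE_span_natCast`), the tree's `(V) ⟹ (E′)` step, and `toGL`.
[cite: Vaserstein1972SL2, Theorem, p. 313] -/
theorem mapGL_mem_closure_upper_lower (hM : 0 < M) (γ : Gamma0 M) (hγ : InGammaH M 3 γ) :
    (mapGL A (γ : SL(2, ℤ)) : G) ∈ Subgroup.closure ((upperGL : Set G) ∪ (lowerGL M : Set G)) := by
  have hV : RelGLeRelE 3 M := relG_top_le_relE_top_of_relG_le_relE _
    (Literature.NumberTheory.Automorphic.SL2Rel.Away.relG_le_relE_span_natCast 3 (by norm_num) M hM.ne')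
  have h := iota_mem_closure_of_relGLeRelE (p := 3) (N := M) Nat.prime_three hV γ hγ
  have h2 := Subgroup.mem_map_of_mem (toGL : SL(2, A) →* G) h
  rw [MonoidHom.map_closure, toGL_iota] at h2
  refine Subgroup.closure_mono ?_ h2
  rintro _ ⟨b, hb | hb, rfl⟩
  · exact Or.inl (toGL_mem_upperGL hb)
  · exact Or.inr (toGL_mem_lowerGL hb)

end Vaserstein

end

end Summit.BirchSwinnertonDyer.BirchSwinnertonDyer.Theorems.MultThreeOrbit
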